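import Literature.Dynamics.IntervalMaps.SharkovskyForcingSteps
import Mathlib.Data.Nat.Factorization.Basic
import HarnessLib

/-!
# Sharkovsky's theorem (the forcing half): if a continuous self-map of a compact interval has a point of least period
# `m` and `m ≺ n` in the Sharkovsky ordering, it has a point of least period `n` (Sharkovsky 1964; Du §13)

Foundations-library file (lane `lit-hodgefound`, prover p24 gen 81; one-dimensional dynamics series, file 4 of the
Sharkovsky package).  ONE DEFINITION (`SharkovskyPrec`, the Sharkovsky ordering, with body) and THEOREMS; no named
fact, net debt 0.  Built on file 3 (Du's steps (a), (b), (c)) and file 1 (Du's Lemma 3 on least periods under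
iterates).

## Sources, VERBATIM

B.-S. Du, *A collection of simple proofs of Sharkovsky's theorem*, arXiv:math/0703592 [Du2007SharkovskyCollection]
(held `paper:arxiv-math_0703592`), §1 (p0001–p0002): «**Theorem (Sharkovsky [mi, sh]).** Let the Sharkovsky's
ordering of the natural numbers be defined as follows:
`3 ≺ 5 ≺ 7 ≺ 9 ≺ ⋯ ≺ 2·3 ≺ 2·5 ≺ 2·7 ≺ 2·9 ≺ ⋯ ≺ 2²·3 ≺ 2²·5 ≺ 2²·7 ≺ 2²·9 ≺ ⋯ ≺ ⋯ ≺ 2³ ≺ 2² ≺ 2 ≺ 1.`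
Then the following three statements hold: (1) Assume that `f : I → I` is a continuous map. If `f` has a period-`m`
point and if `m ≺ n`, then `f` also has a period-`n` point. (2) For each positive integer `n` there exists a continuous
map `f : I → I` that has a period-`n` point but has no period-`m` point for any `m` with `m ≺ n`. (3) There exists a
continuous map `f : I → I` that has a period-`2ⁱ` point for `i = 0, 1, 2, …` but has no periodic point of any other
period.»  and §13 (p0020), the derivation of (1) from (a), (b), (c): «If `f` has period-`m` points with `m ≥ 3` and
odd, then by (b) `f` has period-`(m+2)` points and by (c) `f` has period-`(2·3)` points. If `f` has period-`(2·m)`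
points with `m ≥ 3` and odd, then by Lemma 3, `f²` has period-`m` points. By (b), `f²` has period-`(m+2)` points,
which implies by Lemma 3 that `f` has either period-`(m+2)` points or period-`(2·(m+2))` points. If `f` has
period-`(m+2)` points, then according to (c) `f` has period-`(2·(m+2))` points. In either case, `f` has
period-`(2·(m+2))` points. On the other hand, since `f²` has period-`m` points, by (c) `f²` has period-`(2·3)` points,
hence by Lemma 3, `f` has period-`(2²·3)` points. Now if `f` has period-`(2^k·m)` points with `m ≥ 3` and odd and if
`k ≥ 2`, then by Lemma 3, `f^{2^{k-1}}` has period-`(2·m)` points. It follows from what we have just proved that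
`f^{2^{k-1}}` has period-`(2·(m+2))` points and period-`(2²·3)` points. So, by Lemma 3, `f` has period-`(2^k·(m+2))`
points and period-`(2^{k+1}·3)` points. Consequently, if `f` has period-`(2ⁱ·m)` points with `m ≥ 3` and odd and if
`i ≥ 0`, then by Lemma 3, `f^{2^i}` has period-`m` points. For each `ℓ ≥ i`, by Lemma 3, `f^{2^ℓ} = (f^{2^i})^{2^{ℓ-i}}`
has period-`m` points. By (c), `f^{2^ℓ}` has period-`6` points. So, `f^{2^{ℓ+1}}` has period-`3` points and hence has
period-`2` points. This implies that `f` has period-`2^{ℓ+2}` points for all `ℓ ≥ i`. Finally, if `f` has period-`2^k`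
points for some `k ≥ 2`, then `f^{2^{k-2}}` has period-`4` points and so, by (a), has period-`2` points. Therefore, `f`
has period-`2^{k-1}` points. This proves (1).»

A. N. Sharkovsky, *Coexistence of cycles of a continuous map of the line into itself*, Ukrain. Mat. Zh. 16 (1964)
61–71 [Sharkovsky1964] — the original theorem (statement (1) and its converse).

## What is formalized (all PROVED)

* §1 **`SharkovskyPrec m n`** — the ordering `m ≺ n` above, as a real definition on `ℕ` through the decompositions
  `m = 2^a·p`, `n = 2^b·q` (`p, q` odd): odd parts `> 1` ordered first by the power of two then by the odd part; then
  every non-power-of-two before every power of two; powers of two in decreasing order.  API: uniqueness of the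
  decomposition (`two_pow_mul_odd_inj`), `SharkovskyPrec.pos`, irreflexivity, `sharkovskyPrec_three` (`3` is the
  maximum), `sharkovskyPrec_one` (`1` is the minimum), `SharkovskyPrec.odd_add_two`, numerical instances.
* §2 Du's §13 chain, each link a theorem for a continuous self-map of `[A, B]`: `2^k·m ⇒ 2^k·(m+2)`
  (`exists_minimalPeriod_two_pow_mul_add_two`), `2^k·m ⇒ 2^{k+1}·3` (`exists_minimalPeriod_two_pow_succ_mul_three`),
  `2^i·m ⇒ 2^{ℓ+2}` for `ℓ ≥ i` (`exists_minimalPeriod_two_pow_of_le`), `2^{k+2} ⇒ 2^{k+1}` and `2^k ⇒ 2^j` for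
  `j ≤ k` (`exists_minimalPeriod_two_pow_pred`, `exists_minimalPeriod_two_pow_of_two_pow`), the odd chain and the climb
  (`exists_minimalPeriod_two_pow_mul_of_odd_le`, `exists_minimalPeriod_two_pow_mul_three_of_lt`).
* §3 **`sharkovsky_forcing`** — statement (1) of the theorem; corollaries `exists_minimalPeriod_two_pow_of_not_two_pow`
  (a least period that is not a power of `2` forces every power of `2`) and `exists_minimalPeriod_of_minimalPeriod_three`
  (period `3` forces every period — a second proof of file 2's theorem, through (1)).

NOT formalized: the converse statements (2) and (3) (Du's truncated tent maps), transitivity of `≺` (not needed for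
(1)), Sharkovsky's theorem for maps of a non-compact interval or of the line.  Tree search (FAIL-DUP, 2026-09-01): no
Sharkovsky ordering or theorem in Mathlib or `Literature/` (`lean search 'sharkovsk|Sarkovsk'` → none).
-/

noncomputable section

open Set Function

namespace Literature.Dynamics.IntervalMaps

/-! ## §1 The Sharkovsky ordering -/

/-- **The Sharkovsky ordering** `m ≺ n` of the positive integers (Du's orientation: `m ≺ n` means that a least period
`m` FORCES a least period `n`):
`3 ≺ 5 ≺ 7 ≺ ⋯ ≺ 2·3 ≺ 2·5 ≺ ⋯ ≺ 2²·3 ≺ 2²·5 ≺ ⋯ ≺ 2³ ≺ 2² ≺ 2 ≺ 1`.  Writing `m = 2^a·p`, `n = 2^b·q` with `p, q`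
odd: if `p, q > 1` then `m ≺ n` iff `a < b`, or `a = b` and `p < q`; every `m` with `p > 1` precedes every power of two
(`q = 1`); among powers of two, `2^a ≺ 2^b` iff `b < a`.  (`0` is not related to anything.)
[cite: Sharkovsky1964, Theorem] [cite: Du2007SharkovskyCollection, §1 Theorem (Sharkovsky)] -/
def SharkovskyPrec (m n : ℕ) : Prop :=
  ∃ a p b q : ℕ, m = 2 ^ a * p ∧ n = 2 ^ b * q ∧ Odd p ∧ Odd q ∧
    ((1 < p ∧ 1 < q ∧ (a < b ∨ (a = b ∧ p < q))) ∨ (1 < p ∧ q = 1) ∨ (p = 1 ∧ q = 1 ∧ b < a))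

/-- Uniqueness of the decomposition `2^a·p`, `p` odd. [cite: Du2007SharkovskyCollection, §1 (the ordering is by the
decomposition `2^k·m`, `m` odd)] -/
theorem two_pow_mul_odd_inj {a p b q : ℕ} (hp : Odd p) (hq : Odd q) (h : 2 ^ a * p = 2 ^ b * q) :
    a = b ∧ p = q := by
  wlog hab : a ≤ b generalizing a b p q
  · obtain ⟨h1, h2⟩ := this hq hp h.symm (le_of_not_ge hab)
    exact ⟨h1.symm, h2.symm⟩
  obtain ⟨r, rfl⟩ := Nat.exists_eq_add_of_le hab
  rw [pow_add, mul_assoc] at h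
  have h' : p = 2 ^ r * q := Nat.eq_of_mul_eq_mul_left (pow_pos two_pos a) h
  rcases Nat.eq_zero_or_pos r with hr | hr
  · subst hr; simp at h'; exact ⟨by simp, h'⟩
  · exfalso
    have : Even p := by
      rw [h', show r = r - 1 + 1 by omega, pow_succ]
      exact ⟨2 ^ (r - 1) * q, by ring⟩
    exact (Nat.not_even_iff_odd.2 hp) this

namespace SharkovskyPrec

/-- Both sides of `m ≺ n` are positive. [cite: Du2007SharkovskyCollection, §1 Theorem (Sharkovsky)] -/
theorem pos {m n : ℕ} (h : SharkovskyPrec m n) : 0 < m ∧ 0 < n := by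
  obtain ⟨a, p, b, q, rfl, rfl, hp, hq, -⟩ := h
  exact ⟨Nat.mul_pos (pow_pos two_pos _) hp.pos, Nat.mul_pos (pow_pos two_pos _) hq.pos⟩

/-- The Sharkovsky ordering is irreflexive. [cite: Du2007SharkovskyCollection, §1 Theorem (Sharkovsky)] -/
theorem irrefl (m : ℕ) : ¬ SharkovskyPrec m m := by
  rintro ⟨a, p, b, q, hm, hn, hp, hq, hcases⟩
  obtain ⟨hab, hpq⟩ := two_pow_mul_odd_inj hp hq (hm.symm.trans hn)
  subst hab; subst hpq
  rcases hcases with ⟨-, -, h | ⟨-, h⟩⟩ | ⟨h1, h2⟩ | ⟨-, -, h⟩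
  · exact lt_irrefl _ h
  · exact lt_irrefl _ h
  · omega
  · exact lt_irrefl _ h

/-- An odd `m ≥ 3` precedes `m + 2` (`3 ≺ 5 ≺ 7 ≺ ⋯`). [cite: Du2007SharkovskyCollection, §1 (b)] -/
theorem odd_add_two {m : ℕ} (hodd : Odd m) (hm : 3 ≤ m) : SharkovskyPrec m (m + 2) :=
  ⟨0, m, 0, m + 2, by simp, by simp, hodd, hodd.add_even even_two,
    Or.inl ⟨by omega, by omega, Or.inr ⟨rfl, by omega⟩⟩⟩

/-- `2^a·p` with `p > 1` odd precedes every power of two. [cite: Du2007SharkovskyCollection, §1 Theorem (Sharkovsky)] -/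
theorem two_pow_mul_odd_two_pow {a p : ℕ} (hp : Odd p) (hp1 : 1 < p) (b : ℕ) :
    SharkovskyPrec (2 ^ a * p) (2 ^ b) :=
  ⟨a, p, b, 1, rfl, by simp, hp, odd_one, Or.inr (Or.inl ⟨hp1, rfl⟩)⟩

/-- Powers of two in decreasing order: `2^a ≺ 2^b` for `b < a`.
[cite: Du2007SharkovskyCollection, §1 Theorem (Sharkovsky)] -/
theorem two_pow_two_pow {a b : ℕ} (hba : b < a) : SharkovskyPrec (2 ^ a) (2 ^ b) :=
  ⟨a, 1, b, 1, by simp, by simp, odd_one, odd_one, Or.inr (Or.inr ⟨rfl, rfl, hba⟩)⟩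

end SharkovskyPrec

/-- `3` is the maximum of the Sharkovsky ordering: `3 ≺ n` for every positive `n ≠ 3`.
[cite: Du2007SharkovskyCollection, §1 Theorem (Sharkovsky)] -/
theorem sharkovskyPrec_three {n : ℕ} (hn : 0 < n) (hn3 : n ≠ 3) : SharkovskyPrec 3 n := by
  obtain ⟨b, q, hq, rfl⟩ := Nat.exists_eq_two_pow_mul_odd hn.ne'
  refine ⟨0, 3, b, q, by simp, rfl, ⟨1, rfl⟩, hq, ?_⟩
  rcases Nat.lt_or_ge 1 q with hq1 | hq1
  · left
    refine ⟨by norm_num, hq1, ?_⟩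
    rcases Nat.eq_zero_or_pos b with hb | hb
    · subst hb
      right
      refine ⟨rfl, lt_of_le_of_ne ?_ ?_⟩
      · obtain ⟨s, rfl⟩ := hq; omega
      · rintro rfl; exact hn3 (by simp)
    · exact Or.inl hb
  · right; left
    exact ⟨by norm_num, le_antisymm hq1 hq.pos⟩

/-- `1` is the minimum of the Sharkovsky ordering: `m ≺ 1` for every `m > 1`.
[cite: Du2007SharkovskyCollection, §1 Theorem (Sharkovsky)] -/
theorem sharkovskyPrec_one {m : ℕ} (hm : 1 < m) : SharkovskyPrec m 1 := by
  obtain ⟨a, p, hp, rfl⟩ := Nat.exists_eq_two_pow_mul_odd (by omega : m ≠ 0)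
  rcases Nat.lt_or_ge 1 p with hp1 | hp1
  · simpa using SharkovskyPrec.two_pow_mul_odd_two_pow hp hp1 0
  · have hp' : p = 1 := le_antisymm hp1 hp.pos
    subst hp'
    have ha : 0 < a := by
      rcases Nat.eq_zero_or_pos a with h | h
      · subst h; simp at hm
      · exact h
    simpa using SharkovskyPrec.two_pow_two_pow ha

example : SharkovskyPrec 3 5 := SharkovskyPrec.odd_add_two ⟨1, rfl⟩ le_rfl
example : SharkovskyPrec 6 12 := ⟨1, 3, 2, 3, rfl, rfl, ⟨1, rfl⟩, ⟨1, rfl⟩, Or.inl ⟨by norm_num, by norm_num,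
  Or.inl one_lt_two⟩⟩
example : SharkovskyPrec 10 4 := ⟨1, 5, 2, 1, rfl, rfl, ⟨2, rfl⟩, odd_one, Or.inr (Or.inl ⟨by norm_num, rfl⟩)⟩
example : SharkovskyPrec 4 2 := by simpa using SharkovskyPrec.two_pow_two_pow (a := 2) (b := 1) one_lt_two
example : ¬ SharkovskyPrec 7 7 := SharkovskyPrec.irrefl 7

/-! ## §2 Du's §13: the links of the chain -/

variable {f : ℝ → ℝ} {A B : ℝ}

/-- A continuous self-map of `[A, B]` has a point of least period `1`. [cite: BrinStuck2002, §7.3 Lemma 7.3.2 (1)] -/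
theorem exists_minimalPeriod_one (hf : ContinuousOn f (Icc A B)) (hmaps : MapsTo f (Icc A B) (Icc A B)) {x₀ : ℝ}
    (hx₀ : x₀ ∈ Icc A B) : ∃ y ∈ Icc A B, minimalPeriod f y = 1 := by
  obtain ⟨y, hy, hfy⟩ := exists_fixedPt_of_mapsTo_Icc (hx₀.1.trans hx₀.2) hf hmaps
  exact ⟨y, hy, minimalPeriod_eq_one_iff_isFixedPt.2 hfy⟩

/-- `(f^{2^k})² = f^{2^{k+1}}`. [folklore] -/
private theorem iterate_two_pow_sq (f : ℝ → ℝ) (k : ℕ) : (f^[2 ^ k])^[2] = f^[2 ^ (k + 1)] := by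
  rw [← iterate_mul, ← pow_succ]

/-- **§13, first link.** A point of least period `2^k·m` (`m ≥ 3` odd) forces a point of least period `2^k·(m + 2)`:
for `k = 0` this is (b); for `k ≥ 1`, `f^{2^k}` has a period-`m` point, hence by (b) a period-`(m+2)` point, which has
`f^{2^{k-1}}`-period `m + 2` or `2(m + 2)` (Lemma 3), the former upgraded to `2(m+2)` by (c); Lemma 3 then gives
`f`-period `2^k·(m+2)`. [cite: Du2007SharkovskyCollection, §13] -/
theorem exists_minimalPeriod_two_pow_mul_add_two (hf : ContinuousOn f (Icc A B))
    (hmaps : MapsTo f (Icc A B) (Icc A B)) {x₀ : ℝ} (hx₀ : x₀ ∈ Icc A B) {k m : ℕ} (hm : 3 ≤ m) (hodd : Odd m)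
    (hper : minimalPeriod f x₀ = 2 ^ k * m) : ∃ y ∈ Icc A B, minimalPeriod f y = 2 ^ k * (m + 2) := by
  rcases k with _ | k
  · rw [pow_zero, one_mul] at hper ⊢
    exact exists_minimalPeriod_add_two_of_odd hf hmaps hx₀ hm hodd hper
  · -- `F = f^{2^k}`, `G = F² = f^{2^{k+1}}`
    have hF : ContinuousOn f^[2 ^ k] (Icc A B) := hf.iterate hmaps _
    have hFmaps : MapsTo f^[2 ^ k] (Icc A B) (Icc A B) := hmaps.iterate _
    have hG : ContinuousOn f^[2 ^ (k + 1)] (Icc A B) := hf.iterate hmaps _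
    have hGmaps : MapsTo f^[2 ^ (k + 1)] (Icc A B) (Icc A B) := hmaps.iterate _
    have hGx₀ : minimalPeriod f^[2 ^ (k + 1)] x₀ = m := minimalPeriod_iterate_two_pow_eq_of_odd hper hodd le_rfl
    obtain ⟨y', hy', hGy'⟩ := exists_minimalPeriod_add_two_of_odd hG hGmaps hx₀ hm hodd hGx₀
    have hodd' : Odd (m + 2) := hodd.add_even even_two
    -- a point of `F`-period `2(m+2)`
    obtain ⟨y, hy, hFy⟩ : ∃ y ∈ Icc A B, minimalPeriod f^[2 ^ k] y = 2 * (m + 2) := by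
      rw [← iterate_two_pow_sq] at hGy'
      rcases minimalPeriod_eq_or_of_minimalPeriod_iterate_two hGy' with h | h
      · exact exists_minimalPeriod_two_mul_of_odd hF hFmaps hy' (by omega) hodd' h (by omega)
      · exact ⟨y', hy', h⟩
    refine ⟨y, hy, ?_⟩
    rw [minimalPeriod_eq_mul_of_minimalPeriod_iterate_of_even hFy (even_two_mul _)]
    ring

/-- **§13, second link.** A point of least period `2^k·m` (`m ≥ 3` odd) forces a point of least period `2^{k+1}·3`:
`f^{2^k}` has a period-`m` point, hence by (c) a period-`6` point, whose `f`-period is `2^k·6` (Lemma 3).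
[cite: Du2007SharkovskyCollection, §13] -/
theorem exists_minimalPeriod_two_pow_succ_mul_three (hf : ContinuousOn f (Icc A B))
    (hmaps : MapsTo f (Icc A B) (Icc A B)) {x₀ : ℝ} (hx₀ : x₀ ∈ Icc A B) {k m : ℕ} (hm : 3 ≤ m) (hodd : Odd m)
    (hper : minimalPeriod f x₀ = 2 ^ k * m) : ∃ y ∈ Icc A B, minimalPeriod f y = 2 ^ (k + 1) * 3 := by
  have hG : ContinuousOn f^[2 ^ k] (Icc A B) := hf.iterate hmaps _
  have hGmaps : MapsTo f^[2 ^ k] (Icc A B) (Icc A B) := hmaps.iterate _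
  have hGx₀ : minimalPeriod f^[2 ^ k] x₀ = m := minimalPeriod_iterate_two_pow_eq_of_odd hper hodd le_rfl
  obtain ⟨y, hy, hGy⟩ := exists_minimalPeriod_two_mul_of_odd hG hGmaps hx₀ hm hodd hGx₀ (n := 3) (by norm_num)
  refine ⟨y, hy, ?_⟩
  rw [minimalPeriod_eq_mul_of_minimalPeriod_iterate_of_even hGy (even_two_mul 3)]
  ring

/-- **§13, powers of two above.** A point of least period `2^i·m` (`m ≥ 3` odd) forces a point of least period
`2^{ℓ+2}` for every `ℓ ≥ i`: `f^{2^ℓ}` has a period-`m` point, so by (c) a period-`6` point, so `f^{2^{ℓ+1}}` has a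
period-`3` point and by (a) a period-`2` point, whose `f`-period is `2^{ℓ+2}`. [cite: Du2007SharkovskyCollection, §13] -/
theorem exists_minimalPeriod_two_pow_of_le (hf : ContinuousOn f (Icc A B)) (hmaps : MapsTo f (Icc A B) (Icc A B))
    {x₀ : ℝ} (hx₀ : x₀ ∈ Icc A B) {i m ℓ : ℕ} (hm : 3 ≤ m) (hodd : Odd m) (hper : minimalPeriod f x₀ = 2 ^ i * m)
    (hℓ : i ≤ ℓ) : ∃ y ∈ Icc A B, minimalPeriod f y = 2 ^ (ℓ + 2) := by
  have hG : ContinuousOn f^[2 ^ ℓ] (Icc A B) := hf.iterate hmaps _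
  have hGmaps : MapsTo f^[2 ^ ℓ] (Icc A B) (Icc A B) := hmaps.iterate _
  have hH : ContinuousOn f^[2 ^ (ℓ + 1)] (Icc A B) := hf.iterate hmaps _
  have hHmaps : MapsTo f^[2 ^ (ℓ + 1)] (Icc A B) (Icc A B) := hmaps.iterate _
  have hGx₀ : minimalPeriod f^[2 ^ ℓ] x₀ = m := minimalPeriod_iterate_two_pow_eq_of_odd hper hodd hℓ
  obtain ⟨y', hy', hGy'⟩ := exists_minimalPeriod_two_mul_of_odd hG hGmaps hx₀ hm hodd hGx₀ (n := 3) (by norm_num)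
  have hHy' : minimalPeriod f^[2 ^ (ℓ + 1)] y' = 3 := by
    rw [← iterate_two_pow_sq, minimalPeriod_iterate_eq_div two_ne_zero (by rw [hGy']; norm_num), hGy']
  obtain ⟨y, hy, hHy⟩ := exists_minimalPeriod_two_of_minimalPeriod_ge_three hH hHmaps hy' le_rfl hHy'
  refine ⟨y, hy, ?_⟩
  rw [minimalPeriod_eq_mul_of_minimalPeriod_iterate_of_even hHy even_two]
  ring

/-- **§13, powers of two below.** A point of least period `2^{k+2}` forces a point of least period `2^{k+1}`:
`f^{2^k}` has a period-`4` point, hence by (a) a period-`2` point, whose `f`-period is `2^{k+1}`.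
[cite: Du2007SharkovskyCollection, §13] -/
theorem exists_minimalPeriod_two_pow_pred (hf : ContinuousOn f (Icc A B)) (hmaps : MapsTo f (Icc A B) (Icc A B))
    {x₀ : ℝ} (hx₀ : x₀ ∈ Icc A B) {k : ℕ} (hper : minimalPeriod f x₀ = 2 ^ (k + 2)) :
    ∃ y ∈ Icc A B, minimalPeriod f y = 2 ^ (k + 1) := by
  have hG : ContinuousOn f^[2 ^ k] (Icc A B) := hf.iterate hmaps _
  have hGmaps : MapsTo f^[2 ^ k] (Icc A B) (Icc A B) := hmaps.iterate _
  have hGx₀ : minimalPeriod f^[2 ^ k] x₀ = 4 := by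
    rw [minimalPeriod_iterate_eq_div (pow_ne_zero _ two_ne_zero) (by rw [hper]; exact pow_dvd_pow 2 (by omega)),
      hper, pow_add, Nat.mul_div_cancel_left _ (pow_pos two_pos _)]
    norm_num
  obtain ⟨y, hy, hGy⟩ := exists_minimalPeriod_two_of_minimalPeriod_ge_three hG hGmaps hx₀ (by norm_num) hGx₀
  refine ⟨y, hy, ?_⟩
  rw [minimalPeriod_eq_mul_of_minimalPeriod_iterate_of_even hGy even_two, pow_succ]

/-- Powers of two below, iterated: a point of least period `2^k` forces points of least period `2^j` for all `j ≤ k`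
(`j = 0`: a fixed point). [cite: Du2007SharkovskyCollection, §13] -/
theorem exists_minimalPeriod_two_pow_of_two_pow (hf : ContinuousOn f (Icc A B))
    (hmaps : MapsTo f (Icc A B) (Icc A B)) {k : ℕ} :
    ∀ {x₀ : ℝ}, x₀ ∈ Icc A B → minimalPeriod f x₀ = 2 ^ k → ∀ {j : ℕ}, j ≤ k →
      ∃ y ∈ Icc A B, minimalPeriod f y = 2 ^ j := by
  induction k with
  | zero =>
    intro x₀ hx₀ hper j hj
    have : j = 0 := by omega
    subst this
    exact ⟨x₀, hx₀, hper⟩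
  | succ k ih =>
    intro x₀ hx₀ hper j hj
    rcases hj.lt_or_eq with hj | rfl
    · -- step down to `2^k`, then use the induction hypothesis
      obtain ⟨y, hy, hpy⟩ : ∃ y ∈ Icc A B, minimalPeriod f y = 2 ^ k := by
        rcases k with _ | k
        · simpa using exists_minimalPeriod_one hf hmaps hx₀
        · exact exists_minimalPeriod_two_pow_pred hf hmaps hx₀ hper
      exact ih hy hpy (by omega)
    · exact ⟨x₀, hx₀, hper⟩

/-- The odd chain `2^k·p ⇒ 2^k·q` for odd `3 ≤ p ≤ q` (iterate the first link).
[cite: Du2007SharkovskyCollection, §13] -/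
theorem exists_minimalPeriod_two_pow_mul_of_odd_le (hf : ContinuousOn f (Icc A B))
    (hmaps : MapsTo f (Icc A B) (Icc A B)) {x₀ : ℝ} (hx₀ : x₀ ∈ Icc A B) {k p q : ℕ} (hp : 3 ≤ p) (hpodd : Odd p)
    (hper : minimalPeriod f x₀ = 2 ^ k * p) (hqodd : Odd q) (hpq : p ≤ q) :
    ∃ y ∈ Icc A B, minimalPeriod f y = 2 ^ k * q := by
  obtain ⟨s, hs⟩ := hpodd
  obtain ⟨s', hs'⟩ := hqodd
  obtain ⟨r, hr⟩ : ∃ r, q = p + 2 * r := ⟨s' - s, by omega⟩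
  subst hr
  clear hs' hpq
  induction r with
  | zero => exact ⟨x₀, hx₀, by simpa using hper⟩
  | succ r ih =>
    obtain ⟨y, hy, hpy⟩ := ih
    have := exists_minimalPeriod_two_pow_mul_add_two hf hmaps hy (by omega) ⟨s + r, by omega⟩ hpy
    simpa [show p + 2 * r + 2 = p + 2 * (r + 1) by ring] using this

/-- The climb `2^k·m ⇒ 2^b·3` for `b > k` (`m ≥ 3` odd; iterate the second link).
[cite: Du2007SharkovskyCollection, §13] -/
theorem exists_minimalPeriod_two_pow_mul_three_of_lt (hf : ContinuousOn f (Icc A B))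
    (hmaps : MapsTo f (Icc A B) (Icc A B)) {x₀ : ℝ} (hx₀ : x₀ ∈ Icc A B) {k m b : ℕ} (hm : 3 ≤ m) (hodd : Odd m)
    (hper : minimalPeriod f x₀ = 2 ^ k * m) (hkb : k < b) : ∃ y ∈ Icc A B, minimalPeriod f y = 2 ^ b * 3 := by
  have key : ∀ b, k + 1 ≤ b → ∃ y ∈ Icc A B, minimalPeriod f y = 2 ^ b * 3 := by
    intro b hb
    induction b, hb using Nat.le_induction with
    | base => exact exists_minimalPeriod_two_pow_succ_mul_three hf hmaps hx₀ hm hodd hper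
    | succ b _ ih =>
      obtain ⟨y, hy, hpy⟩ := ih
      exact exists_minimalPeriod_two_pow_succ_mul_three hf hmaps hy le_rfl ⟨1, rfl⟩ hpy
  exact key b hkb

/-! ## §3 Sharkovsky's theorem, statement (1) -/

/-- **Sharkovsky's theorem (forcing half; statement (1) in Du).** Let `f` be a continuous self-map of a compact
interval `[A, B]`. If `f` has a point of least period `m` and `m ≺ n` in the Sharkovsky ordering
`3 ≺ 5 ≺ 7 ≺ ⋯ ≺ 2·3 ≺ 2·5 ≺ ⋯ ≺ 2²·3 ≺ ⋯ ≺ 2³ ≺ 2² ≺ 2 ≺ 1`, then `f` has a point of least period `n`.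
[cite: Sharkovsky1964, Theorem] [cite: Du2007SharkovskyCollection, §1 Theorem (1) and §13] -/
theorem sharkovsky_forcing (hf : ContinuousOn f (Icc A B)) (hmaps : MapsTo f (Icc A B) (Icc A B)) {x₀ : ℝ}
    (hx₀ : x₀ ∈ Icc A B) {m n : ℕ} (hper : minimalPeriod f x₀ = m) (hmn : SharkovskyPrec m n) :
    ∃ y ∈ Icc A B, minimalPeriod f y = n := by
  obtain ⟨a, p, b, q, rfl, rfl, hp, hq, hcases⟩ := hmn
  have hp3 : 1 < p → 3 ≤ p := fun h => by obtain ⟨s, rfl⟩ := hp; omega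
  have hq3 : 1 < q → 3 ≤ q := fun h => by obtain ⟨s, rfl⟩ := hq; omega
  rcases hcases with ⟨hp1, hq1, hab | ⟨rfl, hpq⟩⟩ | ⟨hp1, rfl⟩ | ⟨rfl, rfl, hba⟩
  · -- `a < b`: climb to `2^b·3`, then along the odd chain to `2^b·q`
    obtain ⟨y, hy, hpy⟩ := exists_minimalPeriod_two_pow_mul_three_of_lt hf hmaps hx₀ (hp3 hp1) hp hper hab
    exact exists_minimalPeriod_two_pow_mul_of_odd_le hf hmaps hy le_rfl ⟨1, rfl⟩ hpy hq (hq3 hq1)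
  · -- `a = b`, `p < q`: the odd chain
    exact exists_minimalPeriod_two_pow_mul_of_odd_le hf hmaps hx₀ (hp3 hp1) hp hper hq hpq.le
  · -- `n = 2^b`: up to `2^{a+b+2}`, then down to `2^b`
    obtain ⟨y, hy, hpy⟩ :=
      exists_minimalPeriod_two_pow_of_le hf hmaps hx₀ (hp3 hp1) hp hper (Nat.le_add_right a b)
    simpa using exists_minimalPeriod_two_pow_of_two_pow hf hmaps hy hpy (j := b) (by omega)
  · -- `m = 2^a`, `n = 2^b`, `b < a`
    rw [mul_one] at hper
    simpa using exists_minimalPeriod_two_pow_of_two_pow hf hmaps hx₀ hper hba.le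

/-- A least period that is not a power of two forces every power of two (the part `… ≺ 2³ ≺ 2² ≺ 2 ≺ 1` of the
ordering lies below every `2^a·p`, `p > 1`). [cite: Du2007SharkovskyCollection, §1 Theorem (1)] -/
theorem exists_minimalPeriod_two_pow_of_not_two_pow (hf : ContinuousOn f (Icc A B))
    (hmaps : MapsTo f (Icc A B) (Icc A B)) {x₀ : ℝ} (hx₀ : x₀ ∈ Icc A B) {m : ℕ} (hper : minimalPeriod f x₀ = m)
    (hm0 : m ≠ 0) (hm : ∀ j : ℕ, m ≠ 2 ^ j) (j : ℕ) : ∃ y ∈ Icc A B, minimalPeriod f y = 2 ^ j := by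
  obtain ⟨a, p, hp, rfl⟩ := Nat.exists_eq_two_pow_mul_odd hm0
  have hp1 : 1 < p := lt_of_le_of_ne hp.pos fun h => hm a (by rw [← h, mul_one])
  exact sharkovsky_forcing hf hmaps hx₀ hper (SharkovskyPrec.two_pow_mul_odd_two_pow hp hp1 j)

/-- Period `3` forces every period (`3` is the maximum of the ordering) — a second proof, through statement (1), of
the theorem of file 2. [cite: Du2007SharkovskyCollection, §1 Theorem (1)] [cite: LiYorke1975, Theorem 1 (T1)] -/
theorem exists_minimalPeriod_of_minimalPeriod_three (hf : ContinuousOn f (Icc A B))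
    (hmaps : MapsTo f (Icc A B) (Icc A B)) {x₀ : ℝ} (hx₀ : x₀ ∈ Icc A B) (hper : minimalPeriod f x₀ = 3) {n : ℕ}
    (hn : 0 < n) : ∃ y ∈ Icc A B, minimalPeriod f y = n := by
  by_cases hn3 : n = 3
  · subst hn3; exact ⟨x₀, hx₀, hper⟩
  · exact sharkovsky_forcing hf hmaps hx₀ hper (sharkovskyPrec_three hn hn3)

end Literature.Dynamics.IntervalMaps
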